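import Mathlib

/-!
# N-σ — renormalised nilpotence of the divided skew derivation (w45c dictionary note D-σ §1.7)

Planner sketch (res-L1-w45c-plan-1 g17, 2026-08-29).  Setting of the kill game on
`CyclicQuotientFourfolds` / line `s1a-logminvertex`: `σ` a ring endomorphism of a domain `B` of
characteristic `p` with `σ^[p] = id` (a `ℤ/p`-action), `β` a non-zero `σ`-INVARIANT element
(the exceptional monomial of the frame) dividing every `σ b - b`, and `δ b := (σ b - b)/β` the
renormalised skew derivation (`I_σ = β · (δ B)`).  CLAIM: `δ^[p] = 0`.  Consequence: at every
level of the game the linear part of `δ` at a point of the F-locus is nilpotent, so the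
multiplicative final forms `Σ λⱼ xⱼ ∂ⱼ (λⱼ ∈ 𝔽_p)` of the additive theory (Posva 2025, 1-foliations
in char `p`, dim ≤ 3) — the singularities that cannot be resolved on regular models for `p > 2` —
never occur for `ℤ/p` (on honest charts: for the LINEAR PART at points of F, see note §6).  Proof: `(σ - 1)^[k] b = β^k · δ^[k] b` (induction, uses `σ β = β`), and
`(σ - 1)^p = σ^p - 1 = 0` in the endomorphism ring (characteristic `p`); cancel `β^p ≠ 0`.
-/

namespace Summit.ResolutionOfSingularities.ResolutionOfSingularities.Cruxes.CyclicQuotientFourfolds.Nsigma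

open Function

/-- **Renormalised nilpotence.** If `σ : B →+* B` satisfies `σ^[p] = id` on a domain `B` of
characteristic `p`, `β ≠ 0` is `σ`-invariant and `σ b - b = β * δ b` for every `b`, then
`δ^[p] b = 0` for every `b`. -/
theorem iterate_eq_zero_of_sub_eq_mul {B : Type*} [CommRing B] [IsDomain B] {p : ℕ}
    [hp : Fact p.Prime] [CharP B p] (σ : B →+* B) (hσp : ∀ b, σ^[p] b = b) {β : B} (hβ : β ≠ 0)
    (hσβ : σ β = β) (δ : B → B) (hδ : ∀ b, σ b - b = β * δ b) (b : B) : δ^[p] b = 0 := by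
  -- (1) `(σ - 1)^[k] b = β^k * δ^[k] b`
  have key : ∀ k : ℕ, ∀ b : B, (fun x => σ x - x)^[k] b = β ^ k * δ^[k] b := by
    intro k
    induction k with
    | zero => intro b; simp
    | succ k ih =>
      intro b
      rw [iterate_succ_apply', ih, iterate_succ_apply', map_mul, map_pow, hσβ, ← mul_sub, hδ,
        pow_succ, mul_assoc]
  -- (2) `(σ - 1)^[p] b = 0`, computed in the endomorphism ring `Module.End ℤ B`
  have hTp : (fun x => σ x - x)^[p] b = 0 := by
    let S : Module.End ℤ B := σ.toAddMonoidHom.toIntLinearMap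
    let T : Module.End ℤ B := S - 1
    have hS : ∀ y, S y = σ y := fun y => rfl
    have hT : ∀ y, T y = σ y - y := fun y => rfl
    have hiter : ∀ k : ℕ, ∀ y : B, (fun x => σ x - x)^[k] y = (T ^ k) y := by
      intro k
      induction k with
      | zero => intro y; simp
      | succ k ih => intro y; rw [iterate_succ_apply', ih, pow_succ', Module.End.mul_apply, hT]
    have hSpow : ∀ k : ℕ, ∀ y : B, (S ^ k) y = σ^[k] y := by
      intro k
      induction k with
      | zero => intro y; simp
      | succ k ih => intro y; rw [pow_succ', Module.End.mul_apply, ih, iterate_succ_apply', hS]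
    haveI : CharP (Module.End ℤ B) p := by
      refine (CharP.charP_iff_prime_eq_zero hp.out).mpr ?_
      ext y
      rw [Module.End.natCast_apply, nsmul_eq_mul, CharP.cast_eq_zero, zero_mul,
        LinearMap.zero_apply]
    have hSp : S ^ p = 1 := by
      ext y
      rw [hSpow, hσp, Module.End.one_apply]
    have hcomm : Commute S (1 : Module.End ℤ B) := Commute.one_right _
    have hT0 : T ^ p = 0 := by
      change (S - 1) ^ p = 0
      rw [sub_pow_char_of_commute p hcomm, hSp, one_pow, sub_self]
    rw [hiter, hT0, LinearMap.zero_apply]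
  -- (3) cancel `β^p ≠ 0`
  have h := key p b
  rw [hTp] at h
  exact (mul_eq_zero.mp h.symm).resolve_left (pow_ne_zero _ hβ)

/-- The additive reformulation used downstream: the `p`-fold iterate of the linear part vanishes,
stated for `δ` as an additive map (uniquely determined by `hδ` since `B` is a domain). -/
theorem iterate_eq_zero {B : Type*} [CommRing B] [IsDomain B] {p : ℕ} [Fact p.Prime]
    [CharP B p] (σ : B →+* B) (hσp : ∀ b, σ^[p] b = b) {β : B} (hβ : β ≠ 0) (hσβ : σ β = β)
    (δ : B →+ B) (hδ : ∀ b, σ b - b = β * δ b) : (⇑δ)^[p] = 0 := by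
  funext b
  exact iterate_eq_zero_of_sub_eq_mul σ hσp hβ hσβ δ hδ b

/-- The iterate formula behind N-σ, exposed for consumers: `(σ - 1)^[k] b = β^k * δ^[k] b` (only `σ β = β`
and the defining relation are used; no characteristic or domain hypothesis). -/
theorem iterate_sub_eq_pow_mul_iterate {B : Type*} [CommRing B] (σ : B →+* B) {β : B} (hσβ : σ β = β)
    (δ : B → B) (hδ : ∀ b, σ b - b = β * δ b) (k : ℕ) (b : B) :
    (fun x => σ x - x)^[k] b = β ^ k * δ^[k] b := by
  induction k generalizing b with
  | zero => simp
  | succ k ih =>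
    rw [iterate_succ_apply', ih, iterate_succ_apply', map_mul, map_pow, hσβ, ← mul_sub, hδ, pow_succ,
      mul_assoc]

/-- N-σ for a ring AUTOMORPHISM of order dividing `p` (the frame's form: `τ : L ≃+* L` with `τ ^ p = 1`). -/
theorem iterate_eq_zero_of_ringEquiv {B : Type*} [CommRing B] [IsDomain B] {p : ℕ} [Fact p.Prime]
    [CharP B p] (σ : B ≃+* B) (hσp : σ ^ p = 1) {β : B} (hβ : β ≠ 0) (hσβ : σ β = β)
    (δ : B → B) (hδ : ∀ b, σ b - b = β * δ b) (b : B) : δ^[p] b = 0 := by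
  refine iterate_eq_zero_of_sub_eq_mul (σ : B →+* B) ?_ hβ (by simpa using hσβ) δ (by simpa using hδ) b
  intro x
  have h : ∀ k : ℕ, ∀ y : B, (⇑(σ : B →+* B))^[k] y = (σ ^ k) y := by
    intro k
    induction k with
    | zero => intro y; simp
    | succ k ih => intro y; rw [iterate_succ_apply', ih, pow_succ']; rfl
  rw [h, hσp]; rfl

end Summit.ResolutionOfSingularities.ResolutionOfSingularities.Cruxes.CyclicQuotientFourfolds.Nsigma
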